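import Summits.HubbardSuperconductivity.HubbardSuperconductivity.Theses.KkFloor
import Summits.HubbardSuperconductivity.HubbardSuperconductivity.Theorems.KkBandLift.Negative.NotKkBandLiftOfThermalShell
import Summits.HubbardSuperconductivity.HubbardSuperconductivity.Theorems.KkBandLift.Negative.ThermalShellWitness
import Summits.HubbardSuperconductivity.HubbardSuperconductivity.Theorems.KkFloorBandGlue
import HarnessLib

/-!
# Route `KkFloor`: refutation of the crux `KkSusceptibilityWindow` (stmt-HubbardSuperconductivity-10404)

`KkSusceptibilityWindow` (small-`y` quadratic window): `∃ U > 0, δ ∈ (0,½), κ > 0, y₁ > 0, L₀` such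
that for every even `L ≥ L₀`, every `|y| ≤ y₁` and every eigenvector of `H_L + iy L⁻²Δ_d†Δ_d` in the
doped sector, `Re λ ≥ minEnergyOn + κy²L²`.  FALSE: the proved glue
`kkWindowGivesBand_proof : KkSusceptibilityWindow → KkBandLift` (`Theorems/KkFloorBandGlue.lean`, the
band `[y₁/2, y₁]` with `ε = κy₁²/4`) and `¬ KkBandLift` (`kkBandLift_false_of_thermalShellWitness` +
`thermalShellWitness_of_mem_Ioo`; see `KkFloorKkBandLiftRefutation.lean`).

CLASS `refuted-substantive`: the band / shelf / window is demanded of ALL eigenvectors of the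
pair-penalised pencil in the doped sector, uniformly `Ω(L²)` above the sector ground energy; the
sector always contains unit vectors of energy `≤ E₀ + cL²` with d-wave pair intensity `≤ cL⁴` for
every `c > 0` (thermal shell: Koma–Tasaki decay in the canonical-sector Gibbs state at `β = 4/c`,
entropy budget, ground vector of the budget operator), and the fixed-height Kramers–Kronig floor
(`finiteXFloor`) converts a lift that holds on the whole sector spectrum into
`Ω(L²)` energy-or-pair-order for EVERY unit sector vector — contradiction.  Repairs tried, each still
killed or leaving the route: (i) smaller `ε`, other bands `[Y₁,Y₂]` / thresholds `Y` / windows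
`|y| ≤ y₁` — the witness beats every fixed positive constant; (ii) other couplings / fillings — the
witness holds for all `U : ℝ`, all `δ ≥ -1`; (iii) restricting the lift to eigenvectors near the
bottom of the spectrum — then it is no longer the hypothesis `KkFloorTheorem` / the route glue
consume (a planner's restatement, not a repair of this decl).
barrier-candidate: "thermal-shell census" — no spectral statement quantified over all eigenvectors of
a fixed-sector pair-penalised pencil `H + iyL⁻²Δ†Δ` on the 2D Hubbard torus can carry an `Ω(L²)`
lift, because positive-temperature canonical states have no pair LRO (Koma–Tasaki 1992).

HONEST FRAMING: a DECIDABLE VERDICT (kernel-checked refutation closing a route item), not summit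
progress.  Sources: T. Koma, H. Tasaki, Phys. Rev. Lett. 68 (1992) 3248 (Theorem, eq. (2), (3),
footnote [10]); T. Ransford, Potential Theory in the Complex Plane (1995), Thm 6.4.2.
No definitions.
-/

-- the mandated namespace `Summit.<Summit>.<Problem>.Theorems…` repeats `HubbardSuperconductivity`
-- (single-problem summit, D-0017), which the `dupNamespace` linter flags on every declaration
set_option linter.dupNamespace false

namespace Summit.HubbardSuperconductivity.HubbardSuperconductivity.Theorems

open Summit.HubbardSuperconductivity.HubbardSuperconductivity.Theorems.KkBandLift.Negative
  (kkBandLift_false_of_thermalShellWitness thermalShellWitness_of_mem_Ioo)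

/-- Refutes `KkFloor.KkSusceptibilityWindow` [refuted-substantive]: no `(U, δ, κ, y₁, L₀)` gives a
`κy²L²` lift of the whole doped-sector spectrum of `H_L + iyL⁻²Δ_d†Δ_d` on `|y| ≤ y₁`; witness =
window ⇒ band on `[y₁/2, y₁]` (`kkWindowGivesBand_proof`) ⇒ thermal-shell contradiction; no cheap
repair (module docstring); barrier-candidate: thermal-shell census. [folklore] -/
theorem KkFloorKkSusceptibilityWindow_refuted :
    ¬ Summit.HubbardSuperconductivity.HubbardSuperconductivity.Theses.KkFloor.KkSusceptibilityWindow :=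
  fun h => kkBandLift_false_of_thermalShellWitness
    (fun U δ _ hδ c hc => thermalShellWitness_of_mem_Ioo U δ hδ c hc) (kkWindowGivesBand_proof h)

end Summit.HubbardSuperconductivity.HubbardSuperconductivity.Theorems
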